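import Mathlib
import Summits.Ventures.PercRepro.TriangleCapThreeBelowFourTrianglesB

/-!
# PercRepro — THREE BELOW THE DIAGONAL, FOUR TRIANGLES, PART C: THE THEOREM FOR `k ≥ 10` (p3, gen 38; part 109)

Four 3-cliques through one vertex, pairwise sharing at most one vertex, cover nine vertices
(`nine_le_card_union_of_mem`), so by part B the transversal pairs number at most `2 (k − 9)` for `k ≥ 10`
(`card_transversal_le_two_mul`).  Hence, for a `K₄⁻`-free graph whose triangles are exactly four given ones
(`|T₃| = 24`), with `2m ≥ 6k − 24`: `3 Σ deficit = 3 Σ_{T₃} deficit + 3 Σ₀ ≥ 24 (k − 3) + 3 (2m − 24 − 2 (k − 9))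
≥ 18k`, i.e. `Σ deficit ≥ 6k = |T₃| + 6k − 24`, and **`four_triangles_stability_three_of_ten`**:
`Σ_v d(v)² + 3 (k − 4) ≤ m k` — the case the envelope pays only from `k = 12`.  Numbers (mining/p3/g38/fourtri.c,
every configuration of four triangles, every graph whose triangles are exactly these, `m ≥ 3k − 12`): the gap
`mk − Σ d² − 3(k − 4)` is `≥ 3 / 10 / 18` at `k = 9 / 10 / 11`, and the transversal pairs are at most `1 / 1 / 2`
edges (`0 / 1 / 2` on the dense graphs).  Axioms: standard.
-/

namespace PercRepro

namespace TriangleCap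

namespace C047

open Finset

variable {V : Type*} [Fintype V] [DecidableEq V]

omit [Fintype V] in
/-- Four 3-cliques through `c`, pairwise sharing at most one vertex, cover nine vertices. -/
theorem nine_le_card_union_of_mem (T₁ T₂ T₃ T₄ : Finset V) (h₁ : T₁.card = 3) (h₂ : T₂.card = 3)
    (h₃ : T₃.card = 3) (h₄ : T₄.card = 3) (h12 : (T₁ ∩ T₂).card ≤ 1) (h13 : (T₁ ∩ T₃).card ≤ 1)
    (h14 : (T₁ ∩ T₄).card ≤ 1) (h23 : (T₂ ∩ T₃).card ≤ 1) (h24 : (T₂ ∩ T₄).card ≤ 1) (h34 : (T₃ ∩ T₄).card ≤ 1)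
    {c : V} (hc₁ : c ∈ T₁) (hc₂ : c ∈ T₂) (hc₃ : c ∈ T₃) (hc₄ : c ∈ T₄) :
    9 ≤ (T₁ ∪ T₂ ∪ T₃ ∪ T₄).card := by
  have e12 : (T₁ ∩ T₂).card = 1 := by rw [inter_eq_singleton_of_mem h12 hc₁ hc₂, card_singleton]
  have u12 := card_union_add_card_inter T₁ T₂
  have i3 : ((T₁ ∪ T₂) ∩ T₃).card ≤ 1 := by
    apply card_le_one.mpr
    intro x hx y hy
    rw [mem_inter, mem_union] at hx hy
    have hx' : x = c := by
      rcases hx.1 with h | h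
      · exact card_le_one.mp h13 x (mem_inter.mpr ⟨h, hx.2⟩) c (mem_inter.mpr ⟨hc₁, hc₃⟩)
      · exact card_le_one.mp h23 x (mem_inter.mpr ⟨h, hx.2⟩) c (mem_inter.mpr ⟨hc₂, hc₃⟩)
    have hy' : y = c := by
      rcases hy.1 with h | h
      · exact card_le_one.mp h13 y (mem_inter.mpr ⟨h, hy.2⟩) c (mem_inter.mpr ⟨hc₁, hc₃⟩)
      · exact card_le_one.mp h23 y (mem_inter.mpr ⟨h, hy.2⟩) c (mem_inter.mpr ⟨hc₂, hc₃⟩)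
    rw [hx', hy']
  have u3 := card_union_add_card_inter (T₁ ∪ T₂) T₃
  have i4 : ((T₁ ∪ T₂ ∪ T₃) ∩ T₄).card ≤ 1 := by
    apply card_le_one.mpr
    intro x hx y hy
    rw [mem_inter, mem_union, mem_union] at hx hy
    have hx' : x = c := by
      rcases hx.1 with (h | h) | h
      · exact card_le_one.mp h14 x (mem_inter.mpr ⟨h, hx.2⟩) c (mem_inter.mpr ⟨hc₁, hc₄⟩)
      · exact card_le_one.mp h24 x (mem_inter.mpr ⟨h, hx.2⟩) c (mem_inter.mpr ⟨hc₂, hc₄⟩)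
      · exact card_le_one.mp h34 x (mem_inter.mpr ⟨h, hx.2⟩) c (mem_inter.mpr ⟨hc₃, hc₄⟩)
    have hy' : y = c := by
      rcases hy.1 with (h | h) | h
      · exact card_le_one.mp h14 y (mem_inter.mpr ⟨h, hy.2⟩) c (mem_inter.mpr ⟨hc₁, hc₄⟩)
      · exact card_le_one.mp h24 y (mem_inter.mpr ⟨h, hy.2⟩) c (mem_inter.mpr ⟨hc₂, hc₄⟩)
      · exact card_le_one.mp h34 y (mem_inter.mpr ⟨h, hy.2⟩) c (mem_inter.mpr ⟨hc₃, hc₄⟩)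
    rw [hx', hy']
  have u4 := card_union_add_card_inter (T₁ ∪ T₂ ∪ T₃) T₄
  omega

/-- **THE TRANSVERSAL PAIRS NUMBER AT MOST `2 (k − 9)`** for `k ≥ 10`. -/
theorem card_transversal_le_two_mul (D : SimpleGraph V) [DecidableRel D.Adj] (hK : K4mFree D)
    (T₁ T₂ T₃ T₄ : Finset V) (h₁ : T₁.card = 3) (h₂ : T₂.card = 3) (h₃ : T₃.card = 3) (h₄ : T₄.card = 3)
    (hcl₁ : ∀ x ∈ T₁, ∀ y ∈ T₁, x ≠ y → D.Adj x y) (hcl₂ : ∀ x ∈ T₂, ∀ y ∈ T₂, x ≠ y → D.Adj x y)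
    (hcl₃ : ∀ x ∈ T₃, ∀ y ∈ T₃, x ≠ y → D.Adj x y) (hcl₄ : ∀ x ∈ T₄, ∀ y ∈ T₄, x ≠ y → D.Adj x y)
    (h12 : (T₁ ∩ T₂).card ≤ 1) (h13 : (T₁ ∩ T₃).card ≤ 1) (h14 : (T₁ ∩ T₄).card ≤ 1)
    (h23 : (T₂ ∩ T₃).card ≤ 1) (h24 : (T₂ ∩ T₄).card ≤ 1) (h34 : (T₃ ∩ T₄).card ≤ 1)
    (hk : 10 ≤ Fintype.card V) :
    ((adjPairsAll D).filter (fun p => codeg D p = 0 ∧ deficit D p = 0)).card ≤ 2 * (Fintype.card V - 9) := by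
  rcases card_transversal_le D hK T₁ T₂ T₃ T₄ h₁ h₂ h₃ h₄ hcl₁ hcl₂ hcl₃ hcl₄ h12 h13 h14 h23 h24 h34 with
    h | ⟨c, hc₁, hc₂, hc₃, hc₄, hall⟩
  · omega
  · set U := T₁ ∪ T₂ ∪ T₃ ∪ T₄ with hU
    have hU9 := nine_le_card_union_of_mem T₁ T₂ T₃ T₄ h₁ h₂ h₃ h₄ h12 h13 h14 h23 h24 h34 hc₁ hc₂ hc₃ hc₄
    rw [← hU] at hU9
    have hsub : (adjPairsAll D).filter (fun p => codeg D p = 0 ∧ deficit D p = 0) ⊆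
        Uᶜ.image (fun z => (c, z)) ∪ Uᶜ.image (fun z => (z, c)) := by
      intro p hp
      rw [mem_union, mem_image, mem_image]
      rcases hall p hp with ⟨e1, e2⟩ | ⟨e1, e2⟩
      · exact Or.inl ⟨p.2, mem_compl.mpr e2, by rw [← e1]⟩
      · exact Or.inr ⟨p.1, mem_compl.mpr e2, by rw [← e1]⟩
    have hle := card_le_card hsub
    have hu := card_union_le (Uᶜ.image (fun z => (c, z))) (Uᶜ.image (fun z => (z, c)))
    have hi1 : (Uᶜ.image (fun z => (c, z))).card ≤ Uᶜ.card := card_image_le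
    have hi2 : (Uᶜ.image (fun z => (z, c))).card ≤ Uᶜ.card := card_image_le
    have hUc : Uᶜ.card = Fintype.card V - U.card := card_compl U
    omega

omit [Fintype V] in
/-- A 3-clique as a triple of pairwise adjacent vertices. -/
theorem exists_triple_of_clique (D : SimpleGraph V) [DecidableRel D.Adj] {T : Finset V} (hT : T.card = 3)
    (hcl : ∀ x ∈ T, ∀ y ∈ T, x ≠ y → D.Adj x y) :
    ∃ a b c, D.Adj a b ∧ D.Adj a c ∧ D.Adj b c ∧ T = {a, b, c} := by
  obtain ⟨a, b, c, hab, hac, hbc, rfl⟩ := card_eq_three.mp hT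
  have ha : a ∈ ({a, b, c} : Finset V) := mem_insert_self _ _
  have hb : b ∈ ({a, b, c} : Finset V) := mem_insert_of_mem (mem_insert_self _ _)
  have hc : c ∈ ({a, b, c} : Finset V) := mem_insert_of_mem (mem_insert_of_mem (mem_singleton_self _))
  exact ⟨a, b, c, hcl a ha b hb hab, hcl a ha c hc hac, hcl b hb c hc hbc, rfl⟩

/-- **THREE BELOW THE DIAGONAL, EXACTLY FOUR TRIANGLES, `k ≥ 10`:** `K₄⁻`-free, `2m ≥ 6k − 24`, four distinct
3-cliques carrying every triangle ⇒ `Σ_v d(v)² + 3 (k − 4) ≤ m k`. -/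
theorem four_triangles_stability_three_of_ten (D : SimpleGraph V) [DecidableRel D.Adj] (hK : K4mFree D)
    (hk : 10 ≤ Fintype.card V) (hm : 6 * Fintype.card V ≤ 2 * D.edgeFinset.card + 24)
    (T₁ T₂ T₃ T₄ : Finset V) (h₁ : T₁.card = 3) (h₂ : T₂.card = 3) (h₃ : T₃.card = 3) (h₄ : T₄.card = 3)
    (hcl₁ : ∀ x ∈ T₁, ∀ y ∈ T₁, x ≠ y → D.Adj x y) (hcl₂ : ∀ x ∈ T₂, ∀ y ∈ T₂, x ≠ y → D.Adj x y)
    (hcl₃ : ∀ x ∈ T₃, ∀ y ∈ T₃, x ≠ y → D.Adj x y) (hcl₄ : ∀ x ∈ T₄, ∀ y ∈ T₄, x ≠ y → D.Adj x y)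
    (hne12 : T₁ ≠ T₂) (hne13 : T₁ ≠ T₃) (hne14 : T₁ ≠ T₄) (hne23 : T₂ ≠ T₃) (hne24 : T₂ ≠ T₄) (hne34 : T₃ ≠ T₄)
    (hT : ∀ x y z, D.Adj x y → D.Adj x z → D.Adj y z →
      (x ∈ T₁ ∧ y ∈ T₁) ∨ (x ∈ T₂ ∧ y ∈ T₂) ∨ (x ∈ T₃ ∧ y ∈ T₃) ∨ (x ∈ T₄ ∧ y ∈ T₄)) :
    ∑ v, deg D v * deg D v + 3 * (Fintype.card V - 4) ≤ D.edgeFinset.card * Fintype.card V := by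
  have h12 := inter_card_le_one_of_ne D hK h₁ h₂ hcl₁ hcl₂ hne12
  have h13 := inter_card_le_one_of_ne D hK h₁ h₃ hcl₁ hcl₃ hne13
  have h14 := inter_card_le_one_of_ne D hK h₁ h₄ hcl₁ hcl₄ hne14
  have h23 := inter_card_le_one_of_ne D hK h₂ h₃ hcl₂ hcl₃ hne23
  have h24 := inter_card_le_one_of_ne D hK h₂ h₄ hcl₂ hcl₄ hne24
  have h34 := inter_card_le_one_of_ne D hK h₃ h₄ hcl₃ hcl₄ hne34
  -- `|T₃| = 24`
  have hF : ({T₁, T₂, T₃, T₄} : Finset (Finset V)).card = 4 := by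
    rw [card_insert_of_notMem, card_insert_of_notMem, card_insert_of_notMem, card_singleton]
    · rw [mem_singleton]; exact hne34
    · rw [mem_insert, mem_singleton, not_or]; exact ⟨hne23, hne24⟩
    · rw [mem_insert, mem_insert, mem_singleton, not_or, not_or]; exact ⟨hne12, hne13, hne14⟩
  have h24T := six_mul_card_le_card_triangles3 D {T₁, T₂, T₃, T₄} (by
    intro T hT'
    simp only [mem_insert, mem_singleton] at hT'
    rcases hT' with rfl | rfl | rfl | rfl
    · exact exists_triple_of_clique D h₁ hcl₁
    · exact exists_triple_of_clique D h₂ hcl₂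
    · exact exists_triple_of_clique D h₃ hcl₃
    · exact exists_triple_of_clique D h₄ hcl₄)
  rw [hF] at h24T
  have h24' := card_triangles3_le_twentyfour_of_four D T₁ T₂ T₃ T₄ h₁ h₂ h₃ h₄ hcl₁ hcl₂ hcl₃ hcl₄ hT
    (fun x y z z' hxy hxz hyz hxz' hyz' => eq_of_common_nbr D hK hxy hxz hyz hxz' hyz')
  have hT3 : (triangles3 D).card = 24 := by omega
  -- the counts
  have hsplit := sum_deficit_split D hK
  have hout := card_mul_add_two_mul_sum_outer_le D hK
  have hc0 := card_codeg_zero_add_card_triangles3 D hK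
  have hle := card_codeg_zero_le_sum_deficit_add D
  have htr := card_transversal_le_two_mul D hK T₁ T₂ T₃ T₄ h₁ h₂ h₃ h₄ hcl₁ hcl₂ hcl₃ hcl₄ h12 h13 h14 h23 h24
    h34 hk
  have hid := two_mul_sum_deg_sq_add_sum_deficit D
  rw [hT3] at hout hc0 hid
  have hmk : 2 * D.edgeFinset.card * Fintype.card V = 2 * (D.edgeFinset.card * Fintype.card V) := by ring
  rw [hmk] at hid
  omega

end C047

end TriangleCap

end PercRepro
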